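import Literature.Probability.Divergences.FDivergence
import Literature.Probability.Entropy.StrongDataProcessing
import HarnessLib

/-!
# The stand-alone `χ²`-divergence is the `f`-divergence of `(x - 1)²`

Topic `Literature/Probability/Divergences`; bridge between the earlier stand-alone definition
`Literature.Probability.Entropy.chiSqDiv μ ν = if μ ≪ ν then ∫ (dμ/dν - 1)² dν else ∞`
(vendored with the strong data-processing material of [PolyanskiyWu2017]) and the general
`f`-divergence `Literature.Probability.Divergences.fDiv` of `FDivergence.lean`:
for measures with a Lebesgue decomposition the two agree, because `chiSqFun'(∞) = ∞` makes
`fDiv chiSqFun μ ν = ∞` unless `μ ≪ ν` ([PolyanskiyWu2024, eq. (7.4) and (7.2)]). Proved; no new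
definitions or facts.
-/

noncomputable section

open _root_.MeasureTheory
open scoped ENNReal

namespace Literature.Probability.Divergences

variable {C : Type*} [MeasurableSpace C]

/-- `Literature.Probability.Entropy.chiSqDiv` agrees with the `f`-divergence `chiSqFDiv = fDiv
chiSqFun` whenever `μ` has a Lebesgue decomposition with respect to `ν` (e.g. σ-finite measures).
[cite: PolyanskiyWu2024, eq. (7.4)] -/
theorem chiSqDiv_eq_chiSqFDiv (μ ν : Measure C) [μ.HaveLebesgueDecomposition ν] :
    Literature.Probability.Entropy.chiSqDiv μ ν = chiSqFDiv μ ν := by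
  unfold Literature.Probability.Entropy.chiSqDiv
  split_ifs with h
  · rw [chiSqFDiv, fDiv_of_ac h]
    rfl
  · exact (fDiv_eq_top_of_not_ac derivAtTop_chiSqFun h).symm

/-- In particular Mathlib-style finiteness transfers: `chiSqDiv μ ν ≠ ∞ → μ ≪ ν` read through
`fDiv`. [folklore] -/
theorem ac_of_chiSqFDiv_ne_top {μ ν : Measure C} [μ.HaveLebesgueDecomposition ν]
    (h : chiSqFDiv μ ν ≠ ∞) : μ ≪ ν := by
  by_contra hac
  exact h (fDiv_eq_top_of_not_ac derivAtTop_chiSqFun hac)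

end Literature.Probability.Divergences
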